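import Summits.QuantumFields.YangMills.Theorems.UnitScaleTiltProp7PV3CDEAtSPrint
import Literature.MathematicalPhysics.QuantumFieldTheory.Balaban1983to89.T3ExistSplit
import HarnessLib

/-!
# Route `UnitScaleTilt`, crux K1 child «MinimiserStabilityRegPr» (stmt-QuantumFields-19200), skeleton birth_v8 5b4e8467… — CLAUSE (i) OF LEAF V3 FROM
# `stub_PV3A ∧ stub_PV3C` ALONE, and V3 FROM `stub_PV3A ∧ stub_PV3C ∧ ATTAINMENT` (`T3ExistSplit.MinSixAttainedAt`): the existence clause of
# [Balaban1985Variational] Prop. 7 in the carrier's reading R1 IS attainment of the infimum over print's regular fibre, so rows (D) (landed) and (E) serve only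
# print's ROUTE to attainment (contraction → (112) → axial gauge → (142)); the located ε-bookkeeping of the registered `stub_PV3E`

Cell `ym3-torus`, width seat `ym-ust-19200-w2` (gen 0; OWNER RULING g24-№1 A2′; v8 of record C4a).  YM₃ on T³ is a ladder rung (R3), not the Clay problem; nothing here is a
claim about the crux, d = 4 or the mass gap.

WHY.  (1) The p. 296 uniqueness argument (122) uses Props 2, 5, 6 only — no existence leaf: `Prop7ChartPrint.atMostOneCriticalOrbit_of_props_inj'`.  At the v8 letters
Prop. 5 is a theorem, so «at most one critical orbit in (6)(ε₀), B₃ε₁ ≤ ε₀ ≤ a₀» follows from `stub_PV3A ∧ stub_PV3C` (§1).  (2) The existence clause of V3 reads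
(`T3Thm1Carrier.varProblem3.OnMinimalOrbit`, R1) «some U ∈ (6)(O·L³B₃ε₁) minimises the Wilson action over (6)(O·L³B₃ε₁)» — literally the attainment schema
`T3ExistSplit.MinSixAttainedAt L a₀ a₁ (L³B₃)` at `ε₀ = L³B₃ε₁` (§2).  (3) Hence the registered `stub_PV3E` — which, as typed, lets the (14)-radius `ε₁` float free
of the cap `e ≤ e₅` (its (14)-hypotheses are then idle: every `U₀` is in `𝔘_k(L³B₃ε₁)` for `ε₁` large) and so asserts «EVERY R2-critical configuration in (6)(e) is a
global minimiser over (6)(e)» for all small `e`, MORE than print's (141)–(142) (stated at `ε₀ = O(1)C₁B₃ε₁` for the (7)-datum's own `ε₁`) — is implied, IN PRINT'S REGIME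
`L³B₃ε₁ ≤ e ≤ e₅` and for (7)-data `PlaqSmall ε₁ V`, by uniqueness + attainment + gauge invariance of (5) (§3).  The owner may therefore either re-regime `stub_PV3E`
(text of §3's conclusion) or replace rows (D)+(E) by the attainment row (text of `hATT` in §2); both compositions are sorry-free here.

WHAT IS PROVED (sorry-free, no definition).
§1 **`atMostOneCriticalOrbit_of_A_C`** — clause (i) of `Prop7From14At` at the log-chart letters from (A) and (C) (Prop. 5 and the Sect. A laws being theorems).
§2 **`prop7From14At_of_A_C_att`** — V3 ⇐ (A) ∧ (C) ∧ `∃ a₀′ a₁′ > 0, MinSixAttainedAt L a₀′ a₁′ (L³B₃)`; and **`prop7From14At_v8_of_A_C_att`** at `S_v8 = tPrintFam (sPrint L T)`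
   with the registered texts of `stub_PV3A`, `stub_PV3C`.
§3 **`rowE_regime_of_A_C_att`** — the REGIME form of row (E) («`PlaqSmall ε₁ V`, `L³B₃ε₁ ≤ e ≤ e₅`, … ⇒ `W ∈ (6)(e)` minimises over (6)(e)») from (A), (C) and attainment.

HONEST SCOPE.  (A) ([Balaban1985RegularSpaces] Thm 2 for the based letters), (C) (Props 5–6: contraction) and ATTAINMENT (Thm 1 (8) in reading R1 at radius `≥ L³B₃ε₁`; print's
proof of it IS Prop. 7 (ii) = rows (C)→(D)→(E)) are HYPOTHESES.  This file does not make the crux easier; it says exactly which statement the existence clause is.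
Count-neutral helper toward stmt-QuantumFields-19200 (`--supports`), not a proof of the stub.

References: T. Bałaban, CMP 102 (1985) 277–309 [Balaban1985Variational] (Thm 1 (8) p.279, (4)–(6) p.278, (14) p.280, Prop. 2 p.281, Props 5–6 pp.294–295, (122) p.296,
(141)–(142) p.299, Prop. 7 p.299); CMP 99 (1985) 75–102 [Balaban1985RegularSpaces] ((1.19) p.79, (1.29) p.81, Thm 2 p.83).
-/

noncomputable section

namespace Summit.QuantumFields.YangMills.Theorems.Prop7PV3CDEAttainment


open Literature.MathematicalPhysics.QuantumFieldTheory.Balaban1983to89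
open Literature.MathematicalPhysics.QuantumFieldTheory.Balaban1983to89.T3ContinuumYM3Torus
open Literature.MathematicalPhysics.QuantumFieldTheory.Balaban1983to89.T3UnitLawDensityEML (ℰp)
open Literature.MathematicalPhysics.QuantumFieldTheory.Balaban1983to89.T3DescentFibreTower
open Literature.MathematicalPhysics.QuantumFieldTheory.Balaban1983to89.T3ConstrainedMinimiser
open Literature.MathematicalPhysics.QuantumFieldTheory.Balaban1983to89.T3TiltDescent
open Literature.MathematicalPhysics.QuantumFieldTheory.Balaban1983to89.T3PrintedRegularMinimiser
open Literature.MathematicalPhysics.QuantumFieldTheory.Balaban1983to89.T3PrintedRegularOrbits (descTransf gaugeAct_mem_regFibrePr_iff_of_trivial)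
open B11 (VarProblemX LGData Prop2Printed Prop5Printed Prop6Printed)
open B11Prop7Assembly (Bridge ExistenceLeavesCap one_landau_of_props silent_restrictions eps2_ge_prop2 ineq122_le second_condition_auto)
open B7Prop1Explicit renaming Site → LSite
open B7Prop2Explicit (C0 c2' C0_pos c2'_pos)
open B8Eq119TwistedAxial (InAx Restr129)
open B8Thm4TorusAt (torusLam)
open B15DeterminingSets (embIter)
open B10Eq27TorusAxialLog (pull unitsField toUField)
open B8Thm2SetupTorus (pullGauge toUGauge)
open T3Thm1Carrier
open T3Thm1CarrierNative (IsCritR2 Prop7From14At)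
open T3SectALandauChart
open Summit.QuantumFields.YangMills.Theorems.Prop7ChartInjectivity (sameOrbit_of_eq_law)
open Summit.QuantumFields.YangMills.Theorems.Prop7AxialReprPrint (inj16_print_based)
open Summit.QuantumFields.YangMills.Theorems.Prop7ChartPrint (atMostOneCriticalOrbit_of_props_inj' gaugeFix_of_conditional_axialRepr' axialRepr_print_based_uniform)
open Summit.QuantumFields.YangMills.Theorems.Prop7TPrint
open Summit.QuantumFields.YangMills.Theorems.Prop7SPrint
open Summit.QuantumFields.YangMills.Theorems.Prop7PV3CDELogChart (prop5Printed_logChart prop6Printed_logChart_iff)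
open Summit.QuantumFields.YangMills.Theorems.Prop7PV3CDEAtSPrint (prop2Printed_tPrintFam_iff)
open Literature.MathematicalPhysics.QuantumFieldTheory.Balaban1983to89.T3ExistSplit (MinSixAttainedAt)
open Literature.MathematicalPhysics.QuantumFieldTheory.Balaban1983to89.T3UnitLawGaugeInvariance (gaugeAct_gaugeAct)
open NormedSpace

open scoped Matrix.Norms.L2Operator


variable {L : ℕ}

/-! ## §1 Clause (i) of V3 from (A) and (C) alone -/

/-- **«AT MOST ONE CRITICAL ORBIT IN (6)(ε₀), B₃ε₁ ≤ ε₀ ≤ a₀» FROM (A) AND (C)** at the log-chart letters over print's based Sect. A letters: p. 296 (122) via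
`Prop7ChartPrint.atMostOneCriticalOrbit_of_props_inj'`, Prop. 5 being `prop5Printed_logChart` and the Sect. A laws `Prop7AxialReprPrint`'s theorems; no existence leaf enters.
[cite: Balaban1985Variational, (122) p.296, Prop. 7 p.299, Prop. 2 p.281, Props 5-6 pp.294-295] -/
theorem atMostOneCriticalOrbit_of_A_C (hL : 1 < L) (A : ResidFam L) {B₃ : ℝ} (hB₃ : 1 ≤ B₃)
    (hSax : ∀ (i : Idx L) (U₀ U : GaugeField (i.1.1.P i.1.2.2) 0 (Matrix.specialUnitaryGroup (Fin 2) ℂ)),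
      (A i).IsAxial U₀ U ↔
        InAx (i.1.1.P i.1.2.2).L (i.1.2.2 - i.1.2.1) (torusLam (i.1.2.2 - i.1.2.1))
          (pull (unitsField (toUField U₀)) (embIter (i.1.2.2 - i.1.2.1) (0 : Site (i.1.1.P i.1.2.2) (i.1.2.2 - i.1.2.1))))
          (pull (unitsField (toUField U)) (embIter (i.1.2.2 - i.1.2.1) (0 : Site (i.1.1.P i.1.2.2) (i.1.2.2 - i.1.2.1)))))
    (hSre : ∀ (i : Idx L) (U₀ : GaugeField (i.1.1.P i.1.2.2) 0 (Matrix.specialUnitaryGroup (Fin 2) ℂ))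
      (u : GaugeTransf (i.1.1.P i.1.2.2) 0 (Matrix.specialUnitaryGroup (Fin 2) ℂ)), (A i).Restricted U₀ u →
        Restr129 (i.1.1.P i.1.2.2).L (i.1.2.2 - i.1.2.1) (torusLam (i.1.2.2 - i.1.2.1))
          (pull (unitsField (toUField U₀)) (embIter (i.1.2.2 - i.1.2.1) (0 : Site (i.1.1.P i.1.2.2) (i.1.2.2 - i.1.2.1))))
          (pullGauge (fun x => Unitary.toUnits (toUGauge (i.1.1.P i.1.2.2) 2 u x)) (embIter (i.1.2.2 - i.1.2.1) (0 : Site (i.1.1.P i.1.2.2) (i.1.2.2 - i.1.2.1)))))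
    (hA : ∃ B₁ c₁ : ℝ, 0 < B₁ ∧ 0 < c₁ ∧ Prop2Printed B₁ B₃ ((L : ℝ) ^ 3) c₁ (famLG3 L (tPrintFam A)))
    (hC : ∃ B₀ : ℝ, 0 < B₀ ∧ Prop6Printed B₀ B₃ ((L : ℝ) ^ 3) (famLG3 L (tPrintFam A))) :
    ∃ a₀ : ℝ, 0 < a₀ ∧ ∀ (i : Idx L) (ε₀ ε₁ : ℝ), 0 < ε₁ → ε₀ ≤ a₀ → B₃ * ε₁ ≤ ε₀ →
      ∀ (V : (famX L i).Bdry) (U₀ : (famLG3 L (tPrintFam A) i).Cfg),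
        (famLG3 L (tPrintFam A) i).Sat14 ((L : ℝ) ^ 3 * B₃ * ε₁) ((L : ℝ) ^ 3 * ε₁) ((bridgeFam3 L (tPrintFam A) i).bdry V) U₀ →
          (famX L i).AtMostOneCriticalOrbit ε₀ V := by
  have hL1 : (1 : ℝ) ≤ (L : ℝ) := by exact_mod_cast hL.le
  have hC₁ : (1 : ℝ) ≤ (L : ℝ) ^ 3 := one_le_pow₀ hL1
  have hC₁pos : (0 : ℝ) < (L : ℝ) ^ 3 := by positivity
  have hC0 : 0 < C0 3 := C0_pos _
  have hc2 : 0 < c2' 3 L := c2'_pos _ _ hL.le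
  have he : 0 < min (1 / (6 * C0 3 * (L : ℝ) ^ 3)) (c2' 3 L / (4 * (L : ℝ) ^ 3)) := lt_min (by positivity) (by positivity)
  obtain ⟨B₁, c₁, hB₁, hc₁, h2⟩ := hA
  obtain ⟨B₀, hB₀, h6⟩ := hC
  -- Thm 2's constant reconciled as in `Prop7PillarsPrint`: B₁* := max{B₁, B₀/4}
  set Bs : ℝ := max B₁ (B₀ / 4) with hBs
  have h1 : B₁ ≤ Bs := le_max_left _ _
  have h0 : B₀ / 4 ≤ Bs := le_max_right _ _
  have hBs0 : 0 < Bs := lt_of_lt_of_le hB₁ h1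
  have hB₀Bs : B₀ ≤ 4 * Bs := by linarith
  have h2' : Prop2Printed Bs B₃ ((L : ℝ) ^ 3) c₁ (famLG3 L (tPrintFam A)) := Prop7PillarsPrint.prop2Printed_mono h1 hC₁pos.le h2
  have h5 : Prop5Printed Bs B₃ ((L : ℝ) ^ 3) (famLG3 L (tPrintFam A)) := prop5Printed_logChart A Bs B₃ _
  -- the Sect. A letters of `tPrintFam A` are `A`'s
  have hSax' : ∀ (i : Idx L) (U₀ U : GaugeField (i.1.1.P i.1.2.2) 0 (Matrix.specialUnitaryGroup (Fin 2) ℂ)), (tPrintFam A i).IsAxial U₀ U ↔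
      InAx (i.1.1.P i.1.2.2).L (i.1.2.2 - i.1.2.1) (torusLam (i.1.2.2 - i.1.2.1))
        (pull (unitsField (toUField U₀)) (embIter (i.1.2.2 - i.1.2.1) (0 : Site (i.1.1.P i.1.2.2) (i.1.2.2 - i.1.2.1))))
        (pull (unitsField (toUField U)) (embIter (i.1.2.2 - i.1.2.1) (0 : Site (i.1.1.P i.1.2.2) (i.1.2.2 - i.1.2.1)))) := hSax
  have hSre' : ∀ (i : Idx L) (U₀ : GaugeField (i.1.1.P i.1.2.2) 0 (Matrix.specialUnitaryGroup (Fin 2) ℂ))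
      (u : GaugeTransf (i.1.1.P i.1.2.2) 0 (Matrix.specialUnitaryGroup (Fin 2) ℂ)), (tPrintFam A i).Restricted U₀ u →
        Restr129 (i.1.1.P i.1.2.2).L (i.1.2.2 - i.1.2.1) (torusLam (i.1.2.2 - i.1.2.1))
          (pull (unitsField (toUField U₀)) (embIter (i.1.2.2 - i.1.2.1) (0 : Site (i.1.1.P i.1.2.2) (i.1.2.2 - i.1.2.1))))
          (pullGauge (fun x => Unitary.toUnits (toUGauge (i.1.1.P i.1.2.2) 2 u x)) (embIter (i.1.2.2 - i.1.2.1) (0 : Site (i.1.1.P i.1.2.2) (i.1.2.2 - i.1.2.1)))) :=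
    hSre
  -- CLAUSE (i), p. 296: Props 2, 5, 6 + the two Sect. A laws of `Prop7AxialReprPrint`
  obtain ⟨a₀, ha₀, HU⟩ := atMostOneCriticalOrbit_of_props_inj' (bridgeFam3 L (tPrintFam A)) he
    (fun i ε₀ ε₁ V U₀ U hεe hB₃ε h14 hU hB =>
      gaugeFix_of_conditional_axialRepr' i.1.1 i.2.2.le (tPrintFam A i)
        (fun ε₀ ε₁ V U₀ U hεe hB₃ε h14 hU => by
          obtain ⟨v, hv, hvAx⟩ := axialRepr_print_based_uniform i.1.1 i.2.1 i.2.2.le hC₁ B₃ ε₀ ε₁ V U₀ U hεe hB₃ε h14 hU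
          exact ⟨v, hv, (hSax' i U₀ _).2 (hvAx _)⟩)
        ε₀ ε₁ V U₀ U hεe hB₃ε h14 hU hB)
    (fun i ε₀ V U₀ U₁ u u' hu hu' h18 h18' => by
      show T3Thm1Carrier.SameOrbit i.1.1 i.1.2.1 i.1.2.2 i.2.2.le (emb15 U₀ (act16 U₀ u U₁)) (emb15 U₀ (act16 U₀ u' U₁))
      have h18a : emb15 U₀ (act16 U₀ u U₁) ∈ regFibrePr i.1.1 i.1.2.1 i.1.2.2 i.2.2.le ε₀ V ∧
          (tPrintFam A i).IsAxial U₀ (emb15 U₀ (act16 U₀ u U₁)) := h18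
      have h18b : emb15 U₀ (act16 U₀ u' U₁) ∈ regFibrePr i.1.1 i.1.2.1 i.1.2.2 i.2.2.le ε₀ V ∧
          (tPrintFam A i).IsAxial U₀ (emb15 U₀ (act16 U₀ u' U₁)) := h18'
      rw [emb15_act16] at h18a h18b
      rw [emb15_act16, emb15_act16]
      exact sameOrbit_of_eq_law i.1.1 i.2.2.le (tPrintFam A i)
        (inj16_print_based i.1.1 i.2.2.le (tPrintFam A i) (fun U₀ U hU => (hSax' i U₀ U).1 hU) (hSre' i)) ε₀ V U₀ U₁ u u' hu hu' h18a h18b)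
    (fun i _ _ hUU' => sameOrbit_symm i.1.1 i.2.2.le hUU') (fun i _ _ _ h₁ h₂ => sameOrbit_trans i.1.1 i.2.2.le h₁ h₂)
    hBs0 hB₃ hC₁ hB₀Bs hc₁ h2' h5 h6
  exact ⟨a₀, ha₀, HU⟩

/-! ## §2 V3 from (A), (C) and attainment -/

/-- **LEAF V3 FROM (A), (C) AND ATTAINMENT**: clause (i) by §1; clause (ii) «a minimal orbit in (6)(O·L³B₃ε₁)» (reading R1: a minimiser over print's regular fibre) IS
`MinSixAttainedAt L a₀′ a₁′ (L³B₃)` at `ε₀ = L³B₃ε₁` (`O = 1`), for the (7)-datum `V` of `Prop7From14At`'s binder; `a′₁ = min{a₁′, a₀′/(L³B₃)}`.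
[cite: Balaban1985Variational, Prop. 7 p.299, Thm 1 (8) p.279, (6) p.278] -/
theorem prop7From14At_of_A_C_att (hL : 1 < L) (A : ResidFam L) {B₃ : ℝ} (hB₃ : 1 ≤ B₃)
    (hSax : ∀ (i : Idx L) (U₀ U : GaugeField (i.1.1.P i.1.2.2) 0 (Matrix.specialUnitaryGroup (Fin 2) ℂ)),
      (A i).IsAxial U₀ U ↔
        InAx (i.1.1.P i.1.2.2).L (i.1.2.2 - i.1.2.1) (torusLam (i.1.2.2 - i.1.2.1))
          (pull (unitsField (toUField U₀)) (embIter (i.1.2.2 - i.1.2.1) (0 : Site (i.1.1.P i.1.2.2) (i.1.2.2 - i.1.2.1))))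
          (pull (unitsField (toUField U)) (embIter (i.1.2.2 - i.1.2.1) (0 : Site (i.1.1.P i.1.2.2) (i.1.2.2 - i.1.2.1)))))
    (hSre : ∀ (i : Idx L) (U₀ : GaugeField (i.1.1.P i.1.2.2) 0 (Matrix.specialUnitaryGroup (Fin 2) ℂ))
      (u : GaugeTransf (i.1.1.P i.1.2.2) 0 (Matrix.specialUnitaryGroup (Fin 2) ℂ)), (A i).Restricted U₀ u →
        Restr129 (i.1.1.P i.1.2.2).L (i.1.2.2 - i.1.2.1) (torusLam (i.1.2.2 - i.1.2.1))
          (pull (unitsField (toUField U₀)) (embIter (i.1.2.2 - i.1.2.1) (0 : Site (i.1.1.P i.1.2.2) (i.1.2.2 - i.1.2.1))))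
          (pullGauge (fun x => Unitary.toUnits (toUGauge (i.1.1.P i.1.2.2) 2 u x)) (embIter (i.1.2.2 - i.1.2.1) (0 : Site (i.1.1.P i.1.2.2) (i.1.2.2 - i.1.2.1)))))
    (hA : ∃ B₁ c₁ : ℝ, 0 < B₁ ∧ 0 < c₁ ∧ Prop2Printed B₁ B₃ ((L : ℝ) ^ 3) c₁ (famLG3 L (tPrintFam A)))
    (hC : ∃ B₀ : ℝ, 0 < B₀ ∧ Prop6Printed B₀ B₃ ((L : ℝ) ^ 3) (famLG3 L (tPrintFam A)))
    (hATT : ∃ a₀' a₁' : ℝ, 0 < a₀' ∧ 0 < a₁' ∧ MinSixAttainedAt L a₀' a₁' ((L : ℝ) ^ 3 * B₃)) :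
    Prop7From14At L B₃ := by
  have hL1 : (1 : ℝ) ≤ (L : ℝ) := by exact_mod_cast hL.le
  have hC₁pos : (0 : ℝ) < (L : ℝ) ^ 3 := by positivity
  obtain ⟨a₀, ha₀, HU⟩ := atMostOneCriticalOrbit_of_A_C hL A hB₃ hSax hSre hA hC
  obtain ⟨a₀', a₁', ha₀', ha₁', HATT⟩ := hATT
  have hK : 0 < (L : ℝ) ^ 3 * B₃ := by positivity
  refine ⟨a₀, min a₁' (a₀' / ((L : ℝ) ^ 3 * B₃)), 1, ha₀, lt_min ha₁' (div_pos ha₀' hK), le_rfl, ?_⟩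
  intro i ε₀ ε₁ hε₁ V hV U₀ hU₀ hB
  have h14 : (famLG3 L (tPrintFam A) i).Sat14 ((L : ℝ) ^ 3 * B₃ * ε₁) ((L : ℝ) ^ 3 * ε₁) ((bridgeFam3 L (tPrintFam A) i).bdry V) U₀ := by
    obtain ⟨⟨F, n, K⟩, hF, hnK⟩ := i
    exact sat14T3_of_mem_fibre (mul_pos hC₁pos hε₁) hU₀ hB
  refine ⟨fun hε₀a hB₃ε => HU i ε₀ ε₁ hε₁ hε₀a hB₃ε V U₀ h14, fun hε₁a => ?_⟩
  obtain ⟨⟨F, n, K⟩, hF, hnK⟩ := i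
  have hε₁a₁ : ε₁ ≤ a₁' := hε₁a.trans (min_le_left _ _)
  have hε₀a₀ : (L : ℝ) ^ 3 * B₃ * ε₁ ≤ a₀' := by
    have := (le_div_iff₀ hK).1 (hε₁a.trans (min_le_right _ _)); linarith
  obtain ⟨U, hU, hmin⟩ := HATT F hF n K hnK ε₁ ((L : ℝ) ^ 3 * B₃ * ε₁) hε₁ hε₁a₁ le_rfl hε₀a₀ V hV
  refine ⟨U, ?_⟩
  show U ∈ regFibrePr F n K hnK.le (1 * (L : ℝ) ^ 3 * B₃ * ε₁) V ∧
    IsMinOn (fun W : GaugeField (F.P K) 0 (Matrix.specialUnitaryGroup (Fin 2) ℂ) => wilsonAction4 W) (regFibrePr F n K hnK.le (1 * (L : ℝ) ^ 3 * B₃ * ε₁) V) U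
  rw [one_mul]
  exact ⟨hU, hmin⟩

/-- **THE SAME AT `S_v8 = tPrintFam (sPrint L T)` WITH THE REGISTERED TEXTS OF `stub_PV3A`, `stub_PV3C`** (for the pen): V3 ⇐ (A) ∧ (C) ∧ attainment.
[cite: Balaban1985Variational, Prop. 7 p.299, Thm 1 (8) p.279] -/
theorem prop7From14At_v8_of_A_C_att (hL : 1 < L) (T : ResidFam L) {B₃ : ℝ} (hB₃ : 1 ≤ B₃)
    (hA : ∃ B₁ c₁ : ℝ, 0 < B₁ ∧ 0 < c₁ ∧ Prop2Printed B₁ B₃ ((L : ℝ) ^ 3) c₁ (famLG3 L (sPrint L T)))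
    (hC : ∃ B₀ a₄ : ℝ, 0 < B₀ ∧ 0 < a₄ ∧ ∀ (i : Idx L) (ε₁ ε₄ : ℝ), 0 < ε₁ → ε₄ ≤ a₄ → 2 * B₀ * (L : ℝ) ^ 3 * B₃ * ε₁ ≤ ε₄ →
        ∀ (V : GaugeField (i.1.1.P i.1.2.1) 0 (Matrix.specialUnitaryGroup (Fin 2) ℂ))
          (U₀ : GaugeField (i.1.1.P i.1.2.2) 0 (Matrix.specialUnitaryGroup (Fin 2) ℂ)),
          RegPr i.1.1 i.1.2.1 i.1.2.2 ((L : ℝ) ^ 3 * B₃ * ε₁) U₀ → CloseAvg i.1.1 i.1.2.1 i.1.2.2 i.2.2.le ((L : ℝ) ^ 3 * ε₁) V U₀ →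
          ∃ X : PBond (i.1.1.P i.1.2.2) 0 → Matrix (Fin 2) (Fin 2) ℂ,
            nMax19 i.1.1 i.1.2.1 i.1.2.2 U₀ X < ε₄ ∧
            ((∀ b : PBond (i.1.1.P i.1.2.2) 0, (X b).IsHermitian ∧ Matrix.trace (X b) = 0) ∧ AvgCondPrint i.1.1 i.1.2.1 i.1.2.2 i.2.2.le V U₀ X ∧
              IsLandauPrint i.1.1 i.1.2.1 i.1.2.2 U₀ X ∧ CritLPrint i.1.1 i.1.2.1 i.1.2.2 i.2.2.le V U₀ (expHermField X)) ∧
            nMax19 i.1.1 i.1.2.1 i.1.2.2 U₀ X < 3 * B₀ * (L : ℝ) ^ 3 * B₃ * ε₁ ∧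
            ∀ X' : PBond (i.1.1.P i.1.2.2) 0 → Matrix (Fin 2) (Fin 2) ℂ, nMax19 i.1.1 i.1.2.1 i.1.2.2 U₀ X' < ε₄ →
              ((∀ b : PBond (i.1.1.P i.1.2.2) 0, (X' b).IsHermitian ∧ Matrix.trace (X' b) = 0) ∧ AvgCondPrint i.1.1 i.1.2.1 i.1.2.2 i.2.2.le V U₀ X' ∧
                IsLandauPrint i.1.1 i.1.2.1 i.1.2.2 U₀ X' ∧ CritLPrint i.1.1 i.1.2.1 i.1.2.2 i.2.2.le V U₀ (expHermField X')) → X' = X)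
    (hATT : ∃ a₀' a₁' : ℝ, 0 < a₀' ∧ 0 < a₁' ∧ MinSixAttainedAt L a₀' a₁' ((L : ℝ) ^ 3 * B₃)) :
    Prop7From14At L B₃ := by
  obtain ⟨B₀, a₄, hB₀, ha₄, HC⟩ := hC
  have hC' : ∃ B₀ : ℝ, 0 < B₀ ∧ Prop6Printed B₀ B₃ ((L : ℝ) ^ 3) (famLG3 L (tPrintFam (sPrint L T))) :=
    ⟨B₀, hB₀, (prop6Printed_logChart_iff (sPrint L T)).2 ⟨a₄, ha₄, HC⟩⟩
  have hA' : ∃ B₁ c₁ : ℝ, 0 < B₁ ∧ 0 < c₁ ∧ Prop2Printed B₁ B₃ ((L : ℝ) ^ 3) c₁ (famLG3 L (tPrintFam (sPrint L T))) := by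
    obtain ⟨B₁, c₁, hB₁, hc₁, h2⟩ := hA
    exact ⟨B₁, c₁, hB₁, hc₁, (prop2Printed_tPrintFam_iff (sPrint L T)).2 h2⟩
  exact prop7From14At_of_A_C_att hL (sPrint L T) hB₃ (hSax_sPrint T) (hSre_sPrint T) hA' hC' hATT

/-! ## §3 Row (E) in print's regime from uniqueness, attainment and gauge invariance -/

/-- **ROW (E) IN PRINT'S REGIME FROM (A), (C) AND ATTAINMENT**: for a (7)-datum `V` (`PlaqSmall ε₁ V`), `L³B₃ε₁ ≤ e ≤ e₅ := min{a₀, a₀′}` and `ε₁ ≤ a₁′`, every configuration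
`W ∈ (6)(e) ∩ 𝔅_k(V)` which is critical in reading R2 MINIMISES the Wilson action over (6)(e): attainment gives a minimiser `U*` over (6)(e) (itself R2-critical), uniqueness
(§1, from (A) ∧ (C)) puts `W` on the (4)-orbit of `U*`, and (5) is gauge invariant.  This is [Balaban1985Variational] (141)–(142)'s conclusion «U_k is a minimal configuration
of the functional A(U)» read over the whole regular fibre of radius `ε₀ = O(1)C₁B₃ε₁`; the registered `stub_PV3E` omits the regime `L³B₃ε₁ ≤ e` and the (7)-hypothesis.
[cite: Balaban1985Variational, (141)-(142) p.299, Prop. 7 p.299, (4)-(6) p.278, Thm 1 (8) p.279] -/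
theorem rowE_regime_of_A_C_att (hL : 1 < L) (A : ResidFam L) {B₃ : ℝ} (hB₃ : 1 ≤ B₃)
    (hSax : ∀ (i : Idx L) (U₀ U : GaugeField (i.1.1.P i.1.2.2) 0 (Matrix.specialUnitaryGroup (Fin 2) ℂ)),
      (A i).IsAxial U₀ U ↔
        InAx (i.1.1.P i.1.2.2).L (i.1.2.2 - i.1.2.1) (torusLam (i.1.2.2 - i.1.2.1))
          (pull (unitsField (toUField U₀)) (embIter (i.1.2.2 - i.1.2.1) (0 : Site (i.1.1.P i.1.2.2) (i.1.2.2 - i.1.2.1))))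
          (pull (unitsField (toUField U)) (embIter (i.1.2.2 - i.1.2.1) (0 : Site (i.1.1.P i.1.2.2) (i.1.2.2 - i.1.2.1)))))
    (hSre : ∀ (i : Idx L) (U₀ : GaugeField (i.1.1.P i.1.2.2) 0 (Matrix.specialUnitaryGroup (Fin 2) ℂ))
      (u : GaugeTransf (i.1.1.P i.1.2.2) 0 (Matrix.specialUnitaryGroup (Fin 2) ℂ)), (A i).Restricted U₀ u →
        Restr129 (i.1.1.P i.1.2.2).L (i.1.2.2 - i.1.2.1) (torusLam (i.1.2.2 - i.1.2.1))
          (pull (unitsField (toUField U₀)) (embIter (i.1.2.2 - i.1.2.1) (0 : Site (i.1.1.P i.1.2.2) (i.1.2.2 - i.1.2.1))))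
          (pullGauge (fun x => Unitary.toUnits (toUGauge (i.1.1.P i.1.2.2) 2 u x)) (embIter (i.1.2.2 - i.1.2.1) (0 : Site (i.1.1.P i.1.2.2) (i.1.2.2 - i.1.2.1)))))
    (hA : ∃ B₁ c₁ : ℝ, 0 < B₁ ∧ 0 < c₁ ∧ Prop2Printed B₁ B₃ ((L : ℝ) ^ 3) c₁ (famLG3 L (tPrintFam A)))
    (hC : ∃ B₀ : ℝ, 0 < B₀ ∧ Prop6Printed B₀ B₃ ((L : ℝ) ^ 3) (famLG3 L (tPrintFam A)))
    (hATT : ∃ a₀' a₁' : ℝ, 0 < a₀' ∧ 0 < a₁' ∧ MinSixAttainedAt L a₀' a₁' ((L : ℝ) ^ 3 * B₃)) :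
    ∃ e₅ a₁'' : ℝ, 0 < e₅ ∧ 0 < a₁'' ∧ ∀ (i : Idx L) (e ε₁ : ℝ) (V : GaugeField (i.1.1.P i.1.2.1) 0 (Matrix.specialUnitaryGroup (Fin 2) ℂ))
      (U₀ W : GaugeField (i.1.1.P i.1.2.2) 0 (Matrix.specialUnitaryGroup (Fin 2) ℂ)),
      0 < ε₁ → ε₁ ≤ a₁'' → PlaqSmall ε₁ V → (L : ℝ) ^ 3 * B₃ * ε₁ ≤ e → e ≤ e₅ →
      RegPr i.1.1 i.1.2.1 i.1.2.2 ((L : ℝ) ^ 3 * B₃ * ε₁) U₀ → CloseAvg i.1.1 i.1.2.1 i.1.2.2 i.2.2.le ((L : ℝ) ^ 3 * ε₁) V U₀ →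
      W ∈ regFibrePr i.1.1 i.1.2.1 i.1.2.2 i.2.2.le e V → IsCritR2 i.1.1 i.1.2.1 i.1.2.2 i.2.2.le V W →
        IsMinOn (fun W' : GaugeField (i.1.1.P i.1.2.2) 0 (Matrix.specialUnitaryGroup (Fin 2) ℂ) => wilsonAction4 W')
          (regFibrePr i.1.1 i.1.2.1 i.1.2.2 i.2.2.le e V) W := by
  have hL1 : (1 : ℝ) ≤ (L : ℝ) := by exact_mod_cast hL.le
  have hC₁ : (1 : ℝ) ≤ (L : ℝ) ^ 3 := one_le_pow₀ hL1
  obtain ⟨a₀, ha₀, HU⟩ := atMostOneCriticalOrbit_of_A_C hL A hB₃ hSax hSre hA hC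
  obtain ⟨a₀', a₁', ha₀', ha₁', HATT⟩ := hATT
  refine ⟨min a₀ a₀', a₁', lt_min ha₀ ha₀', ha₁', ?_⟩
  intro i e ε₁ V U₀ W hε₁ hε₁a hV hreg hecap hRU₀ hclose hWmem hWcrit
  obtain ⟨⟨F, n, K⟩, hF, hnK⟩ := i
  have he_a₀ : e ≤ a₀ := hecap.trans (min_le_left _ _)
  have he_a₀' : e ≤ a₀' := hecap.trans (min_le_right _ _)
  have hB₃e : B₃ * ε₁ ≤ e := by
    have : B₃ * ε₁ ≤ (L : ℝ) ^ 3 * B₃ * ε₁ := by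
      have h0 : 0 ≤ B₃ * ε₁ := by positivity
      nlinarith
    exact this.trans hreg
  -- attainment: a minimiser `U*` over (6)(e), itself critical in reading R2
  obtain ⟨Us, hUs, hUsmin⟩ := HATT F hF n K hnK ε₁ e hε₁ hε₁a hreg he_a₀' V hV
  have he0 : 0 < e := lt_of_lt_of_le (by positivity) hreg
  have hUscrit : IsCritR2 F n K hnK.le V Us := T3Thm1CarrierNative.isCritR2_of_isMinOn he0 hUs hUsmin
  -- uniqueness: `W` and `U*` lie on one orbit of (4)
  have h14 : (famLG3 L (tPrintFam A) ⟨(F, n, K), hF, hnK⟩).Sat14 ((L : ℝ) ^ 3 * B₃ * ε₁) ((L : ℝ) ^ 3 * ε₁)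
      ((bridgeFam3 L (tPrintFam A) ⟨(F, n, K), hF, hnK⟩).bdry V) U₀ := ⟨hRU₀, hclose⟩
  have hAM := HU ⟨(F, n, K), hF, hnK⟩ e ε₁ hε₁ he_a₀ hB₃e V U₀ h14
  have hWfib := ((mem_regFibrePr_iff F).mp hWmem)
  have hUsfib := ((mem_regFibrePr_iff F).mp hUs)
  obtain ⟨g, hg, hWg⟩ := hAM W Us hWfib.2 hWfib.1 hWcrit hUsfib.2 hUsfib.1 hUscrit
  -- gauge invariance of (5)
  intro W' hW'
  have hA : wilsonAction4 W = wilsonAction4 Us := by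
    rw [hWg]; exact (T4WilsonGaugeFlatDirection.wilsonAction_gaugeAct 1 g W).symm
  show wilsonAction4 W ≤ wilsonAction4 W'
  rw [hA]
  exact hUsmin hW'

end Summit.QuantumFields.YangMills.Theorems.Prop7PV3CDEAttainment

end
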